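import Summits.QuantumFields.YangMills.Theorems.UnitScaleTiltProp7ColumnRowsOfKernelDecay
import HarnessLib

/-!
# LIFT-THREAD 2 (★★OWNER RULING №30; namer ★w2-19200 g9 PEN ASSIGNMENT v1 17:22:48Z «px12 g11: T1»; token convention (α)(β)(γ) 17:25:31Z) — T1 door twin of
# ✓`UnitScaleTiltProp7ColumnRowsOfKernelDecay`: the theorems `hHcol_of_kernel133_family`, `hΔHcol_of_kernel88_family` VERBATIM with the OPAQUE predicate binder
# `(Lift : ∀ (L : ℕ) (i : Idx L), GaugeField (i.1.1.P i.1.2.2) 0 (Matrix.specialUnitaryGroup (Fin 2) ℂ) → Prop)` (first explicit binder) and the antecedent `Lift L i U₀ →` inserted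
# immediately after the last regularity guard (`RegPr … (α L) U₀ →` ∕ `ρ ≤ α L →`) in the N06-derived rows `h133`, `h88` AND in the op-shaped conclusion; proofs = v1's with
# `hLift` introduced and passed through.  Letters of the v1 file are used BY NAME (imported, not restated).

Cell `ym3-torus`, width seat `ym3-torus-px12` (gen 11).  THEOREMS ONLY (0 `def`, 0 `sorry`); `--supports stmt-QuantumFields-19200 --as helper`, count-neutral.  WHY: px12 g11 LOCATE
«STRATUM (c) AND THE 13 N06 ROWS» (19200 evidence n = 49) + ✓p734809 `Prop7PcolImpliesNSPoincare`: the intrinsic `R_S`-rows of the EX display are inhabitable only on the lift locus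
(`U₀` whose top-level parallel sections lift), so the display S43ᴸT2 carries `Lift L i U₀ →` on the 13 print rows and every door between the display and the junction threads it.
HONEST SCOPE: bookkeeping twin; nothing of print asserted beyond the v1 file; no row, stub or crux is proved; YM₃ on T³ = rung R3 — NOT d = 4, NOT infinite volume, NOT a mass gap, NOT Clay.
References: as in ✓`UnitScaleTiltProp7ColumnRowsOfKernelDecay` (T. Bałaban, CMP 99 (1985) 389–434 [Balaban1985BackgroundPropagators]; CMP 102 (1985) 277–309 [Balaban1985Variational]).
-/

set_option autoImplicit false

noncomputable section

open scoped InnerProductSpace ComplexConjugate Matrix.Norms.L2Operator BigOperators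


open Literature.MathematicalPhysics.QuantumFieldTheory.Balaban1983to89
open Literature.MathematicalPhysics.QuantumFieldTheory.Balaban1983to89.T3ContinuumYM3Torus
open Literature.MathematicalPhysics.QuantumFieldTheory.Balaban1983to89.T3Thm1Carrier
open T3PrintedRegularMinimiser (RegPr)
open B9SectCLatticeCarrier (Bond)
open B11Eq115Space (NegSup NegSize Space115 JetSup levWeight)
open B11Eq111FrakG (nabla115)
open B11Eq90V0primeCurrent (flat115)
open B9Eq3119DeltaPiCarrier (currentCLM)
open B5Eq118OneStroke (iterBlockOf)
open Summit.QuantumFields.YangMills.Theorems.Prop7SectET3Transport (periodsT3 bondEquiv bgOfCfg)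
open Summit.QuantumFields.YangMills.Theorems.Prop7SectET3HilbertLetters (frobEquiv)
open Summit.QuantumFields.YangMills.Theorems.Prop7SectET3CurvedPropagators (H1f)
open Summit.QuantumFields.YangMills.Theorems.Prop7SectET3WilsonHessian (DeltaEtaSlot)
open Summit.QuantumFields.YangMills.Theorems.Prop7SectET3DeltaPiPInv (DeltaPiSlotP)



variable (F : T3Family) (n K : ℕ) (h : n ≤ K)

namespace Summit.QuantumFields.YangMills.Theorems.Prop7ColumnRowsOfKernelDecayLift

open Summit.QuantumFields.YangMills.Theorems.Prop7ColumnRowsOfKernelDecay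

/-- ★★★ **DOOR «H-COLUMN»: S19ᴸ∕S20ᴸ's ∃-MAJORANT ROW `hHcol` FROM PRINT'S (3.133) KERNEL ROW FOR `H`** — at the member letters (`H̃ᴾ := H1f … (DeltaPiSlotP …) U₀`, one-block datum `Pi.single y Z`,
fine reading `flat115 · b′`), the displayed-to-be row `h133` «`‖H̃ᴾ(δ_yZ)(b′)‖ ≤ CH(L)·e^{−(δH(L)∕2)·d(B^{K−n}(b′), y)}·‖Z‖`» ([B9] (3.133) with `(L^{j′}η)^{−d} = 1` at the one-level member, `d` = the
coarse-block ℓ¹ torus distance) gives `hHcol` VERBATIM with `ΘH L := 3·CH L·(2(1 + 2∕δH L))³`. [cite: Balaban1985BackgroundPropagators, (3.133) p.422, Thm 3.12 p.423, (3.126) p.420; Balaban1985Variational, (45)–(46) p.285] -/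
theorem hHcol_of_kernel133_family
    (Lift : ∀ (L : ℕ) (i : Idx L), GaugeField (i.1.1.P i.1.2.2) 0 (Matrix.specialUnitaryGroup (Fin 2) ℂ) → Prop)
    [hFL : ∀ F : T3Family, Fact (0 < (F.L : ℝ))] [hFη : ∀ (F : T3Family) (k : ℕ), Fact (0 < ((F.L : ℝ)⁻¹) ^ k)]
    (α : ℕ → ℝ) (c₀ cB : ℕ → ℝ) [hc₀ : ∀ L : ℕ, Fact (0 < c₀ L)] [hcB : ∀ L : ℕ, Fact (0 < cB L)] (a : ∀ L : ℕ, Idx L → ℝ)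
    (CH δH : ℕ → ℝ) (hCH : ∀ L, 1 < L → 0 ≤ CH L) (hδH : ∀ L, 1 < L → 0 < δH L)
    (h133 : ∀ (L : ℕ), 1 < L → ∀ (i : Idx L) (U₀ : GaugeField (i.1.1.P i.1.2.2) 0 (Matrix.specialUnitaryGroup (Fin 2) ℂ)), RegPr i.1.1 i.1.2.1 i.1.2.2 (α L) U₀ → Lift L i U₀ →
      ∀ (y : PBond (i.1.1.P i.1.2.1) 0) (Z : Matrix (Fin 2) (Fin 2) ℂ) (b' : Bond 3 (periodsT3 i.1.1 i.1.2.2)),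
        ‖flat115 ((H1f i.1.1 i.1.2.1 i.1.2.2 i.2.2.le (c₀ L) (cB L) (a L i) (DeltaPiSlotP i.1.1 i.1.2.1 i.1.2.2 i.2.2.le (c₀ L) (cB L) (a L i)) U₀) (Pi.single y Z)) b'‖
          ≤ CH L * Real.exp (-(δH L / 2 * (Site.tdist (B5Eq118OneStroke.iterBlockOf (i.1.2.2 - i.1.2.1) ((bondEquiv i.1.1 i.1.2.2).symm b').src) (T3LevelShift.siteShift (T3PrintedRegularOrbits.sites_eq i.1.1 i.1.2.1 i.1.2.2 i.2.2.le) y.src) : ℝ))) * ‖Z‖) :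
    ∀ (L : ℕ), 1 < L → ∀ (i : Idx L) (U₀ : GaugeField (i.1.1.P i.1.2.2) 0 (Matrix.specialUnitaryGroup (Fin 2) ℂ)), RegPr i.1.1 i.1.2.1 i.1.2.2 (α L) U₀ → Lift L i U₀ →
      ∃ hk : Bond 3 (periodsT3 i.1.1 i.1.2.2) → PBond (i.1.1.P i.1.2.1) 0 → ℝ, (∀ b' y, 0 ≤ hk b' y) ∧
        (∀ (y : PBond (i.1.1.P i.1.2.1) 0) (Z : Matrix (Fin 2) (Fin 2) ℂ) (b' : Bond 3 (periodsT3 i.1.1 i.1.2.2)), ‖flat115 ((H1f i.1.1 i.1.2.1 i.1.2.2 i.2.2.le (c₀ L) (cB L) (a L i) (DeltaPiSlotP i.1.1 i.1.2.1 i.1.2.2 i.2.2.le (c₀ L) (cB L) (a L i)) U₀) (Pi.single y Z)) b'‖ ≤ hk b' y * ‖Z‖) ∧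
        (∀ y : PBond (i.1.1.P i.1.2.1) 0, ∑ b' : Bond 3 (periodsT3 i.1.1 i.1.2.2), hk b' y ≤ (3 * CH L * (2 * (1 + 2 / δH L)) ^ 3) * ((L : ℝ) ^ (i.1.2.2 - i.1.2.1)) ^ 3) := by
  intro L hL i U₀ hreg hLift
  have hFL' : (i.1.1.L : ℝ) = (L : ℝ) := by rw [i.2.1]
  have hδ : 0 < δH L / 2 := by have := hδH L hL; positivity
  obtain ⟨hk, hk0, hkb, hks⟩ := column_row_of_kernel_decay i.1.1 i.1.2.1 i.1.2.2 i.2.2.le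
    (fun (y : PBond (i.1.1.P i.1.2.1) 0) (Z : Matrix (Fin 2) (Fin 2) ℂ) (b' : Bond 3 (periodsT3 i.1.1 i.1.2.2)) => flat115 ((H1f i.1.1 i.1.2.1 i.1.2.2 i.2.2.le (c₀ L) (cB L) (a L i) (DeltaPiSlotP i.1.1 i.1.2.1 i.1.2.2 i.2.2.le (c₀ L) (cB L) (a L i)) U₀) (Pi.single y Z)) b')
    (hCH L hL) hδ (fun y Z b' => h133 L hL i U₀ hreg hLift y Z b')
  refine ⟨hk, hk0, hkb, fun y => ?_⟩
  have e : 1 / (δH L / 2) = 2 / δH L := by rw [one_div_div]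
  rw [← hFL', ← e]
  exact hks y


/-- ★★★ **DOOR «ΔH-COLUMN»: S19ᴸ∕S20ᴸ's ∃-MAJORANT ROW `hΔHcol` FROM PRINT'S (88)∕(3.132) KERNEL ROW FOR THE COMPOSITE `(Δ_π + DRD*)H = Q*(QGQ*)⁻¹ − Q*aQH`** — at the member letters
(the composite `Δ̃^η ∘ H̃ᴾ` read through `currentCLM … (DeltaEtaSlot …)` and `NegSup.equiv … b′`), the displayed-to-be row `h88` «`‖(Δ̃^η H̃ᴾ(δ_yZ))(b′)‖ ≤ CΔ(L)·e^{−δΔ(L)·d(B^{K−n}(b′), y)}·‖Z‖`»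
gives `hΔHcol` VERBATIM with `ΘΔ L := 3·CΔ L·(2(1 + 1∕δΔ L))³`. [cite: Balaban1985Variational, (86)–(88) p.291; Balaban1985BackgroundPropagators, (3.132) p.422, Thm 3.12 p.423] -/
theorem hΔHcol_of_kernel88_family
    (Lift : ∀ (L : ℕ) (i : Idx L), GaugeField (i.1.1.P i.1.2.2) 0 (Matrix.specialUnitaryGroup (Fin 2) ℂ) → Prop)
    [hFL : ∀ F : T3Family, Fact (0 < (F.L : ℝ))] [hFη : ∀ (F : T3Family) (k : ℕ), Fact (0 < ((F.L : ℝ)⁻¹) ^ k)]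
    (α : ℕ → ℝ) (c₀ cB : ℕ → ℝ) [hc₀ : ∀ L : ℕ, Fact (0 < c₀ L)] [hcB : ∀ L : ℕ, Fact (0 < cB L)] (a : ∀ L : ℕ, Idx L → ℝ)
    (CΔ δΔ : ℕ → ℝ) (hCΔ : ∀ L, 1 < L → 0 ≤ CΔ L) (hδΔ : ∀ L, 1 < L → 0 < δΔ L)
    (h88 : ∀ (L : ℕ), 1 < L → ∀ (i : Idx L) (U₀ : GaugeField (i.1.1.P i.1.2.2) 0 (Matrix.specialUnitaryGroup (Fin 2) ℂ)), RegPr i.1.1 i.1.2.1 i.1.2.2 (α L) U₀ → Lift L i U₀ →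
      ∀ (y : PBond (i.1.1.P i.1.2.1) 0) (Z : Matrix (Fin 2) (Fin 2) ℂ) (b' : Bond 3 (periodsT3 i.1.1 i.1.2.2)),
        ‖NegSup.equiv (levWeight (i.1.1.L : ℝ) (((i.1.1.L : ℝ)⁻¹) ^ (i.1.2.2 - i.1.2.1)) (fun _ : Bond 3 (periodsT3 i.1.1 i.1.2.2) => i.1.2.2 - i.1.2.1) 3) (Matrix (Fin 2) (Fin 2) ℂ) ((currentCLM frobEquiv (fun _ : Bond 3 (periodsT3 i.1.1 i.1.2.2) × Fin 3 => i.1.2.2 - i.1.2.1) (nabla115 (((i.1.1.L : ℝ)⁻¹) ^ (i.1.2.2 - i.1.2.1)) (bgOfCfg i.1.1 i.1.2.2 U₀)) (DeltaEtaSlot i.1.1 i.1.2.1 i.1.2.2 (c₀ L) U₀)) ((H1f i.1.1 i.1.2.1 i.1.2.2 i.2.2.le (c₀ L) (cB L) (a L i) (DeltaPiSlotP i.1.1 i.1.2.1 i.1.2.2 i.2.2.le (c₀ L) (cB L) (a L i)) U₀) (Pi.single y Z))) b'‖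
          ≤ CΔ L * Real.exp (-(δΔ L * (Site.tdist (B5Eq118OneStroke.iterBlockOf (i.1.2.2 - i.1.2.1) ((bondEquiv i.1.1 i.1.2.2).symm b').src) (T3LevelShift.siteShift (T3PrintedRegularOrbits.sites_eq i.1.1 i.1.2.1 i.1.2.2 i.2.2.le) y.src) : ℝ))) * ‖Z‖) :
    ∀ (L : ℕ), 1 < L → ∀ (i : Idx L) (U₀ : GaugeField (i.1.1.P i.1.2.2) 0 (Matrix.specialUnitaryGroup (Fin 2) ℂ)), RegPr i.1.1 i.1.2.1 i.1.2.2 (α L) U₀ → Lift L i U₀ →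
      ∃ hk' : Bond 3 (periodsT3 i.1.1 i.1.2.2) → PBond (i.1.1.P i.1.2.1) 0 → ℝ, (∀ b' y, 0 ≤ hk' b' y) ∧
        (∀ (y : PBond (i.1.1.P i.1.2.1) 0) (Z : Matrix (Fin 2) (Fin 2) ℂ) (b' : Bond 3 (periodsT3 i.1.1 i.1.2.2)), ‖NegSup.equiv (levWeight (i.1.1.L : ℝ) (((i.1.1.L : ℝ)⁻¹) ^ (i.1.2.2 - i.1.2.1)) (fun _ : Bond 3 (periodsT3 i.1.1 i.1.2.2) => i.1.2.2 - i.1.2.1) 3) (Matrix (Fin 2) (Fin 2) ℂ) ((currentCLM frobEquiv (fun _ : Bond 3 (periodsT3 i.1.1 i.1.2.2) × Fin 3 => i.1.2.2 - i.1.2.1) (nabla115 (((i.1.1.L : ℝ)⁻¹) ^ (i.1.2.2 - i.1.2.1)) (bgOfCfg i.1.1 i.1.2.2 U₀)) (DeltaEtaSlot i.1.1 i.1.2.1 i.1.2.2 (c₀ L) U₀)) ((H1f i.1.1 i.1.2.1 i.1.2.2 i.2.2.le (c₀ L) (cB L) (a L i) (DeltaPiSlotP i.1.1 i.1.2.1 i.1.2.2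 i.2.2.le (c₀ L) (cB L) (a L i)) U₀) (Pi.single y Z))) b'‖ ≤ hk' b' y * ‖Z‖) ∧
        (∀ y : PBond (i.1.1.P i.1.2.1) 0, ∑ b' : Bond 3 (periodsT3 i.1.1 i.1.2.2), hk' b' y ≤ (3 * CΔ L * (2 * (1 + 1 / δΔ L)) ^ 3) * ((L : ℝ) ^ (i.1.2.2 - i.1.2.1)) ^ 3) := by
  intro L hL i U₀ hreg hLift
  have hFL' : (i.1.1.L : ℝ) = (L : ℝ) := by rw [i.2.1]
  obtain ⟨hk, hk0, hkb, hks⟩ := column_row_of_kernel_decay i.1.1 i.1.2.1 i.1.2.2 i.2.2.le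
    (fun (y : PBond (i.1.1.P i.1.2.1) 0) (Z : Matrix (Fin 2) (Fin 2) ℂ) (b' : Bond 3 (periodsT3 i.1.1 i.1.2.2)) => NegSup.equiv (levWeight (i.1.1.L : ℝ) (((i.1.1.L : ℝ)⁻¹) ^ (i.1.2.2 - i.1.2.1)) (fun _ : Bond 3 (periodsT3 i.1.1 i.1.2.2) => i.1.2.2 - i.1.2.1) 3) (Matrix (Fin 2) (Fin 2) ℂ) ((currentCLM frobEquiv (fun _ : Bond 3 (periodsT3 i.1.1 i.1.2.2) × Fin 3 => i.1.2.2 - i.1.2.1) (nabla115 (((i.1.1.L : ℝ)⁻¹) ^ (i.1.2.2 - i.1.2.1)) (bgOfCfg i.1.1 i.1.2.2 U₀)) (DeltaEtaSlot i.1.1 i.1.2.1 i.1.2.2 (c₀ L) U₀)) ((H1f i.1.1 i.1.2.1 i.1.2.2 i.2.2.le (c₀ L) (cB L) (a L i) (DeltaPiSlotP i.1.1 i.1.2.1 i.1.2.2 i.2.2.le (c₀ L) (cB L) (a L i)) U₀) (Pi.single y Z))) b')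
    (hCΔ L hL) (hδΔ L hL) (fun y Z b' => h88 L hL i U₀ hreg hLift y Z b')
  refine ⟨hk, hk0, hkb, fun y => ?_⟩
  rw [← hFL']
  exact hks y


end Summit.QuantumFields.YangMills.Theorems.Prop7ColumnRowsOfKernelDecayLift

end
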